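import Mathlib

/-!
# Crux `GrenetZeon.TwoDimCoefficients` (stmt-ValiantsHypothesis-8062) / rung `DualUnipotentThreeHalves` (stmt-24318):
# slot accounting — the dimension of «columns in `U`» + «rows in `V`»

Memo TWENTY-FIRST HAND (evidence on both items), Theorems T1/T2: the Hessian of a window sum
`f = Σ_t tr(N_t ⋯ N_{t+n-2} M_t)` of a consecutive-level graded pencil has, slot by slot, its range inside a
space of `w⁻ × w⁺` matrices of the shape `{A : every column of A lies in U} + {B : every row of B lies in V}`
with `dim U, dim V ≤ μ` (the width of a pivot level).  This file supplies the counting fact that turns that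
inclusion into the per-slot rate `μ·(w⁻ + w⁺) − μ²` (whence `rank Hess tr(X_1⋯X_n) ≤ μ(2m − nμ) ≤ m²/n` for a
block chain of arbitrary widths, the memo's T1):

* `finrank_rowSpace` / `finrank_colSpace` — the two pieces have dimensions `|p|·dim V` and `|q|·dim U`;
* `le_finrank_colSpace_inf_rowSpace` — their intersection has dimension `≥ dim U · dim V` (outer products
  against a basis of `V`);
* ★ `finrank_colSpace_sup_rowSpace_le` — `dim({cols ∈ U} ⊔ {rows ∈ V}) ≤ |q|·dim U + |p|·dim V − dim U·dim V`.

The spaces are written without new definitions: rows in `V` is the image of `Submodule.pi univ (fun _ ↦ V)`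
under `Matrix.ofLinearEquiv`, columns in `U` the transpose (`Matrix.transposeLinearEquiv`) of rows in `U`.
Pure linear algebra over a field; no permanent.  HONEST FRAMING: a brick for the (not yet formalised) slot
calculus of the memo; the stub `DualUnipotentBound`, the 24318 decl and `VP ≠ VNP` remain open.

References: folklore linear algebra.
-/

set_option linter.dupNamespace false
set_option autoImplicit false

namespace Summit.ValiantsHypothesis.ValiantsHypothesis.Theorems.GrenetZeonTwoDimCoefficients.SlotAccounting

open Module

variable {K : Type*} [Field K] {p q : Type*} [Fintype p] [Fintype q]

/-- ROWS IN `V`: the `p × q` matrices all of whose rows lie in `V`, i.e. the image of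
`Submodule.pi Set.univ (fun _ ↦ V)` under `Matrix.of`; its dimension is `|p| · dim V`. [folklore] -/
theorem finrank_rowSpace (V : Submodule K (q → K)) :
    finrank K ↥((Submodule.pi Set.univ (fun _ : p => V)).map
      (Matrix.ofLinearEquiv K : (p → q → K) ≃ₗ[K] Matrix p q K).toLinearMap) =
      Fintype.card p * finrank K V := by
  rw [LinearEquiv.finrank_map_eq]
  -- the row space is the range of the injective map `(p → V) → (p → q → K)`
  let Φ : (p → V) →ₗ[K] (p → q → K) :=
    { toFun := fun g i => (g i : q → K)
      map_add' := by intro g h; funext i; simp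
      map_smul' := by intro c g; funext i; simp }
  have hinj : Function.Injective Φ := by
    intro g h hgh
    funext i
    apply Subtype.ext
    exact congrFun hgh i
  have hrange : LinearMap.range Φ = Submodule.pi Set.univ (fun _ : p => V) := by
    ext M
    simp only [LinearMap.mem_range, Submodule.mem_pi, Set.mem_univ, true_implies]
    constructor
    · rintro ⟨g, rfl⟩ i
      exact (g i).2
    · intro hM
      exact ⟨fun i => ⟨M i, hM i⟩, by funext i; rfl⟩
  rw [← hrange, LinearMap.finrank_range_of_inj hinj, Module.finrank_pi_fintype, Finset.sum_const, Finset.card_univ,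
    smul_eq_mul]

/-- COLUMNS IN `U`: the transpose of «rows in `U`»; its dimension is `|q| · dim U`. [folklore] -/
theorem finrank_colSpace (U : Submodule K (p → K)) :
    finrank K ↥(((Submodule.pi Set.univ (fun _ : q => U)).map
      (Matrix.ofLinearEquiv K : (q → p → K) ≃ₗ[K] Matrix q p K).toLinearMap).map
      (Matrix.transposeLinearEquiv q p K K).toLinearMap) = Fintype.card q * finrank K U := by
  rw [LinearEquiv.finrank_map_eq]
  exact finrank_rowSpace (p := q) U

/-- Outer products against a basis of `V`: the intersection «columns in `U`» ⊓ «rows in `V`» has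
dimension at least `dim U · dim V`. [folklore] -/
theorem le_finrank_colSpace_inf_rowSpace (U : Submodule K (p → K)) (V : Submodule K (q → K)) :
    finrank K U * finrank K V ≤
      finrank K ↥((((Submodule.pi Set.univ (fun _ : q => U)).map
          (Matrix.ofLinearEquiv K : (q → p → K) ≃ₗ[K] Matrix q p K).toLinearMap).map
          (Matrix.transposeLinearEquiv q p K K).toLinearMap) ⊓
        ((Submodule.pi Set.univ (fun _ : p => V)).map
          (Matrix.ofLinearEquiv K : (p → q → K) ≃ₗ[K] Matrix p q K).toLinearMap)) := by
  classical
  -- a basis of `V`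
  let bV := Module.finBasis K V
  set v := finrank K V with hv
  -- `Θ g = Σ_l (g l) ⊗ (bV l)`
  let Θ : (Fin v → U) →ₗ[K] Matrix p q K :=
    { toFun := fun g => Matrix.of fun i j => ∑ l, (g l : p → K) i * (bV l : q → K) j
      map_add' := by
        intro g h; ext i j
        simp only [Matrix.of_apply, Pi.add_apply, Submodule.coe_add, add_mul, Finset.sum_add_distrib,
          Matrix.add_apply]
      map_smul' := by
        intro c g; ext i j
        simp only [Matrix.of_apply, Pi.smul_apply, Submodule.coe_smul, smul_eq_mul, RingHom.id_apply,
          Finset.mul_sum, mul_assoc, Matrix.smul_apply] }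
  have hΘ : ∀ g i j, Θ g i j = ∑ l, (g l : p → K) i * (bV l : q → K) j := fun g i j => rfl
  -- `Θ` is injective: the rows of `Θ g` are coordinate expansions in the basis `bV`
  have hinj : Function.Injective Θ := by
    rw [← LinearMap.ker_eq_bot, LinearMap.ker_eq_bot']
    intro g hg
    have hli : LinearIndependent K (fun l => (bV l : q → K)) :=
      bV.linearIndependent.map' V.subtype (Submodule.ker_subtype V)
    funext l
    apply Subtype.ext
    funext i
    have hrow : ∑ l, ((g l : p → K) i) • (bV l : q → K) = 0 := by
      funext j
      have := congrFun (congrFun hg i) j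
      rw [hΘ] at this
      simpa [Finset.sum_apply, Pi.smul_apply, smul_eq_mul] using this
    have := Fintype.linearIndependent_iff.mp hli (fun l => (g l : p → K) i) hrow l
    simpa using this
  -- the range of `Θ` lies in the intersection
  have hle : LinearMap.range Θ ≤
      (((Submodule.pi Set.univ (fun _ : q => U)).map
          (Matrix.ofLinearEquiv K : (q → p → K) ≃ₗ[K] Matrix q p K).toLinearMap).map
          (Matrix.transposeLinearEquiv q p K K).toLinearMap) ⊓
        ((Submodule.pi Set.univ (fun _ : p => V)).map
          (Matrix.ofLinearEquiv K : (p → q → K) ≃ₗ[K] Matrix p q K).toLinearMap) := by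
    rintro M ⟨g, rfl⟩
    have hcol : ∀ j, (fun i => ∑ l, (g l : p → K) i * (bV l : q → K) j) ∈ U := by
      intro j
      have : (fun i => ∑ l, (g l : p → K) i * (bV l : q → K) j) =
          ∑ l, ((bV l : q → K) j) • (g l : p → K) := by
        funext i; simp [Finset.sum_apply, Pi.smul_apply, smul_eq_mul, mul_comm]
      rw [this]
      exact U.sum_mem fun l _ => U.smul_mem _ (g l).2
    have hrow : ∀ i, (fun j => ∑ l, (g l : p → K) i * (bV l : q → K) j) ∈ V := by
      intro i
      have : (fun j => ∑ l, (g l : p → K) i * (bV l : q → K) j) =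
          ∑ l, ((g l : p → K) i) • (bV l : q → K) := by
        funext j; simp [Finset.sum_apply, Pi.smul_apply, smul_eq_mul]
      rw [this]
      exact V.sum_mem fun l _ => V.smul_mem _ (bV l).2
    rw [Submodule.mem_inf]
    refine ⟨?_, ?_⟩
    · rw [Submodule.mem_map]
      refine ⟨Matrix.of fun j i => ∑ l, (g l : p → K) i * (bV l : q → K) j, ?_, ?_⟩
      · rw [Submodule.mem_map]
        exact ⟨fun j i => ∑ l, (g l : p → K) i * (bV l : q → K) j, fun j _ => hcol j, rfl⟩
      · ext i j; rfl
    · rw [Submodule.mem_map]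
      exact ⟨fun i j => ∑ l, (g l : p → K) i * (bV l : q → K) j, fun i _ => hrow i, rfl⟩
  calc finrank K U * finrank K V = finrank K (Fin v → U) := by
        rw [Module.finrank_pi_fintype, Finset.sum_const, Finset.card_univ, Fintype.card_fin, smul_eq_mul,
          mul_comm]
    _ = finrank K ↥(LinearMap.range Θ) := (LinearMap.finrank_range_of_inj hinj).symm
    _ ≤ _ := Submodule.finrank_mono hle

/-- ★ **Slot accounting.**  For `p × q` matrices over a field,
`dim({columns in U} ⊔ {rows in V}) ≤ |q|·dim U + |p|·dim V − dim U·dim V`.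
With `dim U, dim V ≤ μ` this is the per-slot rate `μ(w⁻ + w⁺) − μ²` of the memo's Theorem T1. [folklore] -/
theorem finrank_colSpace_sup_rowSpace_le (U : Submodule K (p → K)) (V : Submodule K (q → K)) :
    finrank K ↥((((Submodule.pi Set.univ (fun _ : q => U)).map
          (Matrix.ofLinearEquiv K : (q → p → K) ≃ₗ[K] Matrix q p K).toLinearMap).map
          (Matrix.transposeLinearEquiv q p K K).toLinearMap) ⊔
        ((Submodule.pi Set.univ (fun _ : p => V)).map
          (Matrix.ofLinearEquiv K : (p → q → K) ≃ₗ[K] Matrix p q K).toLinearMap)) ≤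
      Fintype.card q * finrank K U + Fintype.card p * finrank K V - finrank K U * finrank K V := by
  set A : Submodule K (Matrix p q K) :=
    ((Submodule.pi Set.univ (fun _ : q => U)).map
      (Matrix.ofLinearEquiv K : (q → p → K) ≃ₗ[K] Matrix q p K).toLinearMap).map
      (Matrix.transposeLinearEquiv q p K K).toLinearMap with hA
  set B : Submodule K (Matrix p q K) :=
    (Submodule.pi Set.univ (fun _ : p => V)).map
      (Matrix.ofLinearEquiv K : (p → q → K) ≃ₗ[K] Matrix p q K).toLinearMap with hB
  have hsum := Submodule.finrank_sup_add_finrank_inf_eq A B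
  have h1 : finrank K ↥A = Fintype.card q * finrank K U := finrank_colSpace U
  have h2 : finrank K ↥B = Fintype.card p * finrank K V := finrank_rowSpace V
  have hinf : finrank K U * finrank K V ≤ finrank K ↥(A ⊓ B) := le_finrank_colSpace_inf_rowSpace U V
  omega


/-! ## Membership: how the terms `A·Y·B` of a slot map land in the two pieces (append, same hand)

In the slot calculus the map `Y ↦ C_τ(Y) = Σ_σ A_σ·Y_σ·B_σ` has every term either with the columns of `A_σ`
inside a fixed `U` (then `A_σ·Y·B_σ ∈ {cols ∈ U}` for every `Y`) or with the rows of `B_σ` inside a fixed `V`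
(then `A_σ·Y·B_σ ∈ {rows ∈ V}`); so `range C_τ ≤ {cols ∈ U} ⊔ {rows ∈ V}` and the rate follows
(`finrank_le_of_le_colSpace_sup_rowSpace`). -/

omit [Fintype p] [Fintype q] in
/-- Membership in «rows in `V`»: all rows of the matrix lie in `V`. [folklore] -/
theorem mem_rowSpace_iff (V : Submodule K (q → K)) (M : Matrix p q K) :
    M ∈ (Submodule.pi Set.univ (fun _ : p => V)).map
        (Matrix.ofLinearEquiv K : (p → q → K) ≃ₗ[K] Matrix p q K).toLinearMap ↔ ∀ i, M i ∈ V := by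
  rw [Submodule.mem_map]
  constructor
  · rintro ⟨f, hf, rfl⟩ i
    exact hf i (Set.mem_univ i)
  · intro hM
    exact ⟨fun i j => M i j, fun i _ => hM i, rfl⟩

omit [Fintype p] [Fintype q] in
/-- Membership in «columns in `U`»: all columns of the matrix lie in `U`. [folklore] -/
theorem mem_colSpace_iff (U : Submodule K (p → K)) (M : Matrix p q K) :
    M ∈ ((Submodule.pi Set.univ (fun _ : q => U)).map
        (Matrix.ofLinearEquiv K : (q → p → K) ≃ₗ[K] Matrix q p K).toLinearMap).map
        (Matrix.transposeLinearEquiv q p K K).toLinearMap ↔ ∀ j, (fun i => M i j) ∈ U := by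
  rw [Submodule.mem_map]
  constructor
  · rintro ⟨N, hN, rfl⟩ j
    rw [mem_rowSpace_iff] at hN
    exact hN j
  · intro hM
    refine ⟨Matrix.of fun j i => M i j, ?_, ?_⟩
    · rw [mem_rowSpace_iff]
      exact hM
    · ext i j; rfl

omit [Fintype p] [Fintype q] in
/-- If every row of `B` lies in `V`, then every row of `A·Y·B` lies in `V` (rows of a product are combinations
of the rows of the right factor). [folklore] -/
theorem mul_mul_mem_rowSpace (V : Submodule K (q → K)) {r s : Type*} [Fintype r] [Fintype s]
    (A : Matrix p r K) (Y : Matrix r s K) (B : Matrix s q K) (hB : ∀ k, B k ∈ V) :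
    A * Y * B ∈ (Submodule.pi Set.univ (fun _ : p => V)).map
        (Matrix.ofLinearEquiv K : (p → q → K) ≃ₗ[K] Matrix p q K).toLinearMap := by
  rw [mem_rowSpace_iff]
  intro i
  have : (A * Y * B) i = ∑ k, (A * Y) i k • B k := by
    funext j
    simp [Matrix.mul_apply, Finset.sum_apply, Pi.smul_apply, smul_eq_mul]
  rw [this]
  exact V.sum_mem fun k _ => V.smul_mem _ (hB k)

omit [Fintype p] [Fintype q] in
/-- If every column of `A` lies in `U`, then every column of `A·Y·B` lies in `U`. [folklore] -/
theorem mul_mul_mem_colSpace (U : Submodule K (p → K)) {r s : Type*} [Fintype r] [Fintype s]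
    (A : Matrix p r K) (Y : Matrix r s K) (B : Matrix s q K) (hA : ∀ k, (fun i => A i k) ∈ U) :
    A * Y * B ∈ ((Submodule.pi Set.univ (fun _ : q => U)).map
        (Matrix.ofLinearEquiv K : (q → p → K) ≃ₗ[K] Matrix q p K).toLinearMap).map
        (Matrix.transposeLinearEquiv q p K K).toLinearMap := by
  rw [mem_colSpace_iff]
  intro j
  have : (fun i => (A * Y * B) i j) = ∑ k, ((Y * B) k j) • (fun i => A i k) := by
    funext i
    rw [Matrix.mul_assoc, Matrix.mul_apply, Finset.sum_apply]
    refine Finset.sum_congr rfl fun k _ => ?_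
    rw [Pi.smul_apply, smul_eq_mul, mul_comm]
  rw [this]
  exact U.sum_mem fun k _ => U.smul_mem _ (hA k)

/-- ★ **The per-slot rate.**  Any subspace of `p × q` matrices contained in «columns in `U`» ⊔ «rows in `V`»
has dimension `≤ |q|·dim U + |p|·dim V − dim U·dim V`; in the slot calculus this is applied to the range of
`Y ↦ C_τ(Y)` with `dim U, dim V ≤ μ`, giving `μ(w⁻ + w⁺) − μ²`. [folklore] -/
theorem finrank_le_of_le_colSpace_sup_rowSpace (U : Submodule K (p → K)) (V : Submodule K (q → K))
    (S : Submodule K (Matrix p q K))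
    (hS : S ≤ (((Submodule.pi Set.univ (fun _ : q => U)).map
          (Matrix.ofLinearEquiv K : (q → p → K) ≃ₗ[K] Matrix q p K).toLinearMap).map
          (Matrix.transposeLinearEquiv q p K K).toLinearMap) ⊔
        ((Submodule.pi Set.univ (fun _ : p => V)).map
          (Matrix.ofLinearEquiv K : (p → q → K) ≃ₗ[K] Matrix p q K).toLinearMap)) :
    finrank K S ≤ Fintype.card q * finrank K U + Fintype.card p * finrank K V - finrank K U * finrank K V :=
  (Submodule.finrank_mono hS).trans (finrank_colSpace_sup_rowSpace_le U V)

/-- The rate in the form used by Theorem T1 of the memo: with `dim U ≤ μ`, `dim V ≤ μ`, `μ ≤ |p|`, `μ ≤ |q|`,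
a subspace of «cols ∈ U» ⊔ «rows ∈ V» has dimension `≤ μ·(|p| + |q|) − μ²`. [folklore] -/
theorem finrank_le_slotRate (U : Submodule K (p → K)) (V : Submodule K (q → K)) (μ : ℕ)
    (hU : finrank K U ≤ μ) (hV : finrank K V ≤ μ) (hp : μ ≤ Fintype.card p) (hq : μ ≤ Fintype.card q)
    (S : Submodule K (Matrix p q K))
    (hS : S ≤ (((Submodule.pi Set.univ (fun _ : q => U)).map
          (Matrix.ofLinearEquiv K : (q → p → K) ≃ₗ[K] Matrix q p K).toLinearMap).map
          (Matrix.transposeLinearEquiv q p K K).toLinearMap) ⊔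
        ((Submodule.pi Set.univ (fun _ : p => V)).map
          (Matrix.ofLinearEquiv K : (p → q → K) ≃ₗ[K] Matrix p q K).toLinearMap)) :
    finrank K S ≤ μ * (Fintype.card p + Fintype.card q) - μ * μ := by
  have h := finrank_le_of_le_colSpace_sup_rowSpace U V S hS
  -- monotonicity of `u·|q| + |p|·v − u·v` in `u ≤ μ ≤ |p|` and `v ≤ μ ≤ |q|`
  set u := finrank K U with hu
  set v := finrank K V with hv'
  have key : Fintype.card q * u + Fintype.card p * v - u * v ≤ μ * (Fintype.card p + Fintype.card q) - μ * μ := by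
    have h1 : Fintype.card q * u + Fintype.card p * v + μ * μ ≤ μ * (Fintype.card p + Fintype.card q) + u * v := by
      nlinarith [Nat.mul_le_mul hU hV, mul_le_mul_of_nonneg_left hq (Nat.zero_le (μ - u)),
        Nat.sub_add_cancel hU, Nat.sub_add_cancel hV, mul_le_mul_of_nonneg_left hp (Nat.zero_le (μ - v))]
    omega
  exact h.trans key


/-! ## The two assembly steps of the slot calculus (append, same hand): the SLOT MAP rate
`finrank_range_le_slotRate_of_sum` and the ACCOUNTING step `finrank_range_pi_le` (a map into a product has
`dim range ≤ Σ_τ dim range` of its components — the Hessian read slot by slot). -/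

/-- ★ **Slot map rate.**  If `C(y) = Σ_σ A_σ·L_σ(y)·B_σ` (any functions `L_σ`, any inner sizes) and for every
`σ` either all columns of `A_σ` lie in `U` or all rows of `B_σ` lie in `V`, with `dim U, dim V ≤ μ ≤ |p|, |q|`,
then `dim range C ≤ μ·(|p| + |q|) − μ²`. [folklore] -/
theorem finrank_range_le_slotRate_of_sum (U : Submodule K (p → K)) (V : Submodule K (q → K)) (μ : ℕ)
    (hU : finrank K U ≤ μ) (hV : finrank K V ≤ μ) (hp : μ ≤ Fintype.card p) (hq : μ ≤ Fintype.card q)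
    {ι : Type*} [Fintype ι] (r s : ι → Type*) [∀ i, Fintype (r i)] [∀ i, Fintype (s i)]
    {Y : Type*} [AddCommGroup Y] [Module K Y]
    (A : ∀ i, Matrix p (r i) K) (L : ∀ i, Y → Matrix (r i) (s i) K) (B : ∀ i, Matrix (s i) q K)
    (h : ∀ i, (∀ k, (fun a => A i a k) ∈ U) ∨ (∀ k, B i k ∈ V))
    (C : Y →ₗ[K] Matrix p q K) (hC : ∀ y, C y = ∑ i, A i * L i y * B i) :
    finrank K ↥(LinearMap.range C) ≤ μ * (Fintype.card p + Fintype.card q) - μ * μ := by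
  refine finrank_le_slotRate U V μ hU hV hp hq (LinearMap.range C) ?_
  rintro _ ⟨y, rfl⟩
  rw [hC]
  refine Submodule.sum_mem _ fun i _ => ?_
  rcases h i with hA | hB
  · exact Submodule.mem_sup_left (mul_mul_mem_colSpace U (A i) (L i y) (B i) hA)
  · exact Submodule.mem_sup_right (mul_mul_mem_rowSpace V (A i) (L i y) (B i) hB)

/-- Dimension of a product of subspaces: `dim (Π_i S_i) = Σ_i dim S_i` for `Submodule.pi`. [folklore] -/
theorem finrank_submodulePi {ι : Type*} [Fintype ι] {W : ι → Type*} [∀ i, AddCommGroup (W i)]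
    [∀ i, Module K (W i)] [∀ i, FiniteDimensional K (W i)] (S : ∀ i, Submodule K (W i)) :
    finrank K ↥(Submodule.pi Set.univ S) = ∑ i, finrank K ↥(S i) := by
  let Φ : (∀ i, S i) →ₗ[K] (∀ i, W i) :=
    { toFun := fun g i => (g i : W i)
      map_add' := by intro g h; funext i; simp
      map_smul' := by intro c g; funext i; simp }
  have hinj : Function.Injective Φ := by
    intro g h hgh
    funext i
    apply Subtype.ext
    exact congrFun hgh i
  have hrange : LinearMap.range Φ = Submodule.pi Set.univ S := by
    ext x
    simp only [LinearMap.mem_range, Submodule.mem_pi, Set.mem_univ, true_implies]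
    constructor
    · rintro ⟨g, rfl⟩ i
      exact (g i).2
    · intro hx
      exact ⟨fun i => ⟨x i, hx i⟩, by funext i; rfl⟩
  rw [← hrange, LinearMap.finrank_range_of_inj hinj, Module.finrank_pi_fintype]

/-- ★ **Accounting step.**  A linear map into a finite product has `dim range ≤ Σ_i dim range` of its
components.  (Applied to the Hessian of a multi-affine polynomial read slot by slot.) [folklore] -/
theorem finrank_range_pi_le {ι : Type*} [Fintype ι] {W : ι → Type*} [∀ i, AddCommGroup (W i)]
    [∀ i, Module K (W i)] [∀ i, FiniteDimensional K (W i)]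
    {Y : Type*} [AddCommGroup Y] [Module K Y] (C : ∀ i, Y →ₗ[K] W i) :
    finrank K ↥(LinearMap.range (LinearMap.pi C)) ≤ ∑ i, finrank K ↥(LinearMap.range (C i)) := by
  have hle : LinearMap.range (LinearMap.pi C) ≤ Submodule.pi Set.univ (fun i => LinearMap.range (C i)) := by
    rintro _ ⟨y, rfl⟩ i _
    exact ⟨y, rfl⟩
  exact (Submodule.finrank_mono hle).trans (finrank_submodulePi _).le


/-! ## Chains through a pivot level (append, same hand): in T1 the fixed spaces are the column space of a chain
prefix `P = N_{s+1}⋯N_{i₀−1}` (dim ≤ |level i₀| = μ) and the row span of a suffix `Q = N_{i₀}⋯N_{s−1}`. -/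

omit [Fintype p] [Fintype q] in
/-- The columns of `P·X` lie in the column space of `P`. [folklore] -/
theorem col_mul_mem_range_mulVecLin {r s : Type*} [Fintype r] (P : Matrix p r K) (X : Matrix r s K) (k : s) :
    (fun a => (P * X) a k) ∈ LinearMap.range P.mulVecLin := by
  refine ⟨fun j => X j k, ?_⟩
  funext a
  simp [Matrix.mul_apply, Matrix.mulVec, dotProduct]

omit [Fintype p] [Fintype q] in
/-- The rows of `X·Q` lie in the span of the rows of `Q`. [folklore] -/
theorem row_mul_mem_span_rows {r s : Type*} [Fintype r] (X : Matrix s r K) (Q : Matrix r q K) (i : s) :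
    (X * Q) i ∈ Submodule.span K (Set.range fun j : r => Q j) := by
  have : (X * Q) i = ∑ j, X i j • Q j := by
    funext b
    simp [Matrix.mul_apply, Finset.sum_apply, Pi.smul_apply, smul_eq_mul]
  rw [this]
  exact Submodule.sum_mem _ fun j _ => Submodule.smul_mem _ _ (Submodule.subset_span ⟨j, rfl⟩)

omit [Fintype p] [Fintype q] in
/-- The column space of `P : p × r` has dimension `≤ |r|`. [folklore] -/
theorem finrank_range_mulVecLin_le_card {r : Type*} [Fintype r] (P : Matrix p r K) :
    finrank K ↥(LinearMap.range P.mulVecLin) ≤ Fintype.card r := by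
  have := Matrix.rank_le_card_width P
  simpa [Matrix.rank] using this

omit [Fintype p] [Fintype q] in
/-- The row span of `Q : r × q` has dimension `≤ |r|`. [folklore] -/
theorem finrank_span_rows_le_card {r : Type*} [Fintype r] (Q : Matrix r q K) :
    finrank K ↥(Submodule.span K (Set.range fun j : r => Q j)) ≤ Fintype.card r :=
  finrank_range_le_card _

/-- ★ **Theorem T1, matrix form of one slot.**  Let `C(y) = Σ_σ A_σ·L_σ(y)·B_σ` be a slot map into
`p × q` matrices such that every term factors through a PIVOT LEVEL of size `≤ μ`: either
`A_σ = P·A'_σ` with a common `P : p × r₀`, `|r₀| ≤ μ`, or `B_σ = B'_σ·Q` with a common `Q : r₁ × q`, `|r₁| ≤ μ`.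
If `μ ≤ |p|` and `μ ≤ |q|` then `dim range C ≤ μ·(|p| + |q|) − μ²`. [folklore] -/
theorem finrank_range_le_slotRate_of_pivot (μ : ℕ) (hp : μ ≤ Fintype.card p) (hq : μ ≤ Fintype.card q)
    {r₀ r₁ : Type*} [Fintype r₀] [Fintype r₁] (P : Matrix p r₀ K) (Q : Matrix r₁ q K)
    (hP : Fintype.card r₀ ≤ μ) (hQ : Fintype.card r₁ ≤ μ)
    {ι : Type*} [Fintype ι] (r s : ι → Type*) [∀ i, Fintype (r i)] [∀ i, Fintype (s i)]
    {Y : Type*} [AddCommGroup Y] [Module K Y]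
    (A : ∀ i, Matrix p (r i) K) (L : ∀ i, Y → Matrix (r i) (s i) K) (B : ∀ i, Matrix (s i) q K)
    (h : ∀ i, (∃ A' : Matrix r₀ (r i) K, A i = P * A') ∨ (∃ B' : Matrix (s i) r₁ K, B i = B' * Q))
    (C : Y →ₗ[K] Matrix p q K) (hC : ∀ y, C y = ∑ i, A i * L i y * B i) :
    finrank K ↥(LinearMap.range C) ≤ μ * (Fintype.card p + Fintype.card q) - μ * μ := by
  refine finrank_range_le_slotRate_of_sum (LinearMap.range P.mulVecLin)
    (Submodule.span K (Set.range fun j : r₁ => Q j)) μ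
    ((finrank_range_mulVecLin_le_card P).trans hP) ((finrank_span_rows_le_card Q).trans hQ) hp hq
    r s A L B (fun i => ?_) C hC
  rcases h i with ⟨A', hA'⟩ | ⟨B', hB'⟩
  · left
    intro k
    rw [hA']
    exact col_mul_mem_range_mulVecLin P A' k
  · right
    intro k
    rw [hB']
    exact row_mul_mem_span_rows B' Q k

end Summit.ValiantsHypothesis.ValiantsHypothesis.Theorems.GrenetZeonTwoDimCoefficients.SlotAccounting
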